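import Summits.QuantumFields.YangMills.Theorems.UnitScaleTiltProp7CovariantLocalMinimality
import HarnessLib

/-!
# Route `UnitScaleTilt`, crux K1 child «MinimiserStabilityRegPr» (stmt-QuantumFields-19200), registered stub `stub_prop7From14` (v4 828f5fb4a904d3be;
# V3 = `T3Thm1CarrierNative.Prop7From14At`) — [B9] Thm 3.11 in `L²` form and the non-flat local-minimality model OFF THE KERNEL of the covariant averaging:
# the averaging term `Q^*Q` is KEPT (print's `Δ₁ + DRD^* + aQ^*Q`), so the statements apply to fluctuations that are only APPROXIMATELY average-free —
# the form needed once the linearised (0.4)-constraint `d(descendTo)_{U₀}Y = 0` is identified with `A^{U₀}Y = (corrections)` (split card V3-D1c)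

Cell `ym3-torus` ∕ fleet seat `ym-ust-19200-p1` (HUMAN RULING D-0037, YM ladder rung R3), successor g2.  The seat's `UnitScaleTiltProp7SmallFieldThm311` and
`UnitScaleTiltProp7CovariantLocalMinimality` are stated ON the kernel `A^{U₀}Y = 0` of the covariant straight-line block averaging; print's operator carries the
averaging as the penalty `aQ^*Q` instead.  THIS FILE re-assembles both with the averaging term on the right-hand side (from the general covariant Poincaré
`sum_normSq_le_covLineAvg_add_covGrad`, no kernel hypothesis), at the d = 3 carrier:
* **`sum_normSq_le_curl_sq_add_divB_sq_add_avg_T3`**: `dist1(U₀(∂p)) ≤ εL^{−2(K−n)}`, `216ε ≤ 1` ⇒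
  `L^{−2(K−n)}Σ_b‖Y(b)‖² ≤ 18(Σ_{x,μ<ν}‖(D_{U₀}Y)(p_{μν}(x))‖²_HS + Σ_x‖(D^*_{U₀}Y)(x)‖²_HS) + 16·(L^{3(K−n)}L^{2(K−n)})^{−1}L^{−2(K−n)}·Σ_c‖A^{U₀}_cY‖²`
  — Thm 3.11's «Δ₁ + DD^* + Q^*Q ≥ γ₀η²» with explicit absolute constants, every `M₂(ℂ)`-valued bond field `Y`;
* **`wilsonAction4_sub_background_ge_offKernel_T3`**: the non-flat local-minimality model with the Landau condition `D^*_{U₀}Y = 0` kept and the average-zero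
  condition replaced by the penalty: `((1/288)L^{−2(K−n)} − 12(2a² + 128δ² + 8a))Σ_b‖Y(b)‖² − (1/18)(L^{3(K−n)}L^{2(K−n)})^{−1}L^{−2(K−n)}Σ_c‖A^{U₀}_cY‖²
  ≤ A(U) − A(U₀) − Lin_{U₀}(U)` (`a = εL^{−2(K−n)}`, `Y = UU₀^* − 1`, `‖Y(b)‖ ≤ δ ≤ 1`).
Sorry-free, no definitions; MODEL caveats as in the parent files; nothing of Bałaban's is asserted.

References: T. Bałaban, CMP 99 (1985) 389–434 [Balaban1985BackgroundPropagators] (Thm 3.11 p.416); CMP 102 (1985) 277–309 [Balaban1985Variational] ((14) p.280,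
(20)–(21) p.281, (141)–(143) p.299).
-/

noncomputable section

open scoped BigOperators Matrix.Norms.L2Operator Matrix

namespace Summit.QuantumFields.YangMills.Theorems.Prop7CovariantCoercivity

open Literature.MathematicalPhysics.QuantumFieldTheory.Balaban1983to89
open Finset B1RG242Torus
open B7Prop1Explicit (plaqWord U1 treeWord)
open B7Eq78Linearization (conjR)
open B9Eq39Adjoint (R R_def covD curl divB)
open B10StarCount (sum_pbond)
open B10Eq27TorusAxialLog (holT unitsField toUField unitsField_mem_unitaryUnits)
open B9TorusCalculus (torusT torusT_apply)
open Summit.QuantumFields.YangMills.Theorems.Prop7FlatLocalMin (sum_plaq_bonds_le)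

/-! ## §1 [B9] Thm 3.11 in `L²` form OFF the kernel of the covariant averaging (the averaging term kept on the right) -/

/-- **[B9] THM 3.11 IN `L²` FORM OFF THE KERNEL, d = 3 CARRIER**: for an `SU(2)` background with `dist1(U₀(∂p)) ≤ εL^{−2(K−n)}`, `216ε ≤ 1`, and every `M₂(ℂ)`-valued
bond field `Y`: `L^{−2(K−n)}Σ_b‖Y(b)‖² ≤ 18(Σ‖D_{U₀}Y‖²_HS + Σ‖D^*_{U₀}Y‖²_HS) + 16·(L^{3(K−n)}L^{2(K−n)})^{−1}L^{−2(K−n)}·Σ_c‖A^{U₀}_cY‖²` — curl, divergence AND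
averaging terms on the right (print's `Δ₁ + DRD^* + aQ^*Q`, full `D^*` for `RD^*`), absolute constants, uniform in `m`, `n`, `K`.
[cite: Balaban1985BackgroundPropagators, Thm 3.11 p.416] -/
theorem sum_normSq_le_curl_sq_add_divB_sq_add_avg_T3 (F : T3ContinuumYM3Torus.T3Family) (n K : ℕ)
    (U₀ : GaugeField (F.P K) 0 (Matrix.specialUnitaryGroup (Fin 2) ℂ)) {ε : ℝ} (hε : 0 ≤ ε) (hε1 : 216 * ε ≤ 1)
    (hU : ∀ p : Plaq (F.P K) 0, dist1 (GaugeField.plaqHol U₀ p) ≤ ε * (((F.L : ℝ) ^ (K - n)) ^ 2)⁻¹)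
    (Y : PBond (F.P K) 0 → Matrix (Fin 2) (Fin 2) ℂ) :
    (((F.L : ℝ) ^ (K - n)) ^ 2)⁻¹ * ∑ b : PBond (F.P K) 0, ‖Y b‖ ^ 2
      ≤ 18 * (∑ x : Site (F.P K) 0, ∑ μ : Fin (F.P K).d, ∑ ν : Fin (F.P K).d,
            (if μ < ν then ∑ j : Fin 2, ∑ k : Fin 2,
              ‖(curl (torusT (F.P K) 0) (fun κ z => unitsField (toUField U₀) ⟨z, κ⟩) (fun κ z => Y ⟨z, κ⟩) μ ν x) j k‖ ^ 2 else 0)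
          + ∑ x : Site (F.P K) 0, ∑ j : Fin 2, ∑ k : Fin 2,
              ‖(divB (torusT (F.P K) 0) (fun κ z => unitsField (toUField U₀) ⟨z, κ⟩) (fun κ z => Y ⟨z, κ⟩) x) j k‖ ^ 2)
        + 16 * (((((F.L : ℝ) ^ (K - n)) ^ (F.P K).d) * ((F.L : ℝ) ^ (K - n)) ^ 2)⁻¹ * (((F.L : ℝ) ^ (K - n)) ^ 2)⁻¹)
          * ∑ c : PBond (F.P K) (K - n), ‖∑ r : Fin (F.P K).d → Fin ((F.P K).L ^ (K - n)), ∑ t ∈ range ((F.P K).L ^ (K - n)),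
        conjR (holT (unitsField (toUField U₀)) (Site.fibreSite 0 (K - n) c.src fun _ => ⟨0, pow_pos (F.P K).L_pos (K - n)⟩)
              (treeWord fun ν => ((r ν : ℕ) : ℤ))
            * holT (unitsField (toUField U₀)) (Site.fibreSite 0 (K - n) c.src r) (List.replicate t (c.dir, true)))
          (Y ⟨(fun z : Site (F.P K) 0 => z.shift c.dir)^[t] (Site.fibreSite 0 (K - n) c.src r), c.dir⟩)‖ ^ 2 := by
  obtain ⟨hV, hplaq⟩ := hyp_of_specialUnitary U₀ hU
  have hVu : ∀ b, (unitsField (toUField U₀) b : Matrix (Fin 2) (Fin 2) ℂ) ∈ unitary (Matrix (Fin 2) (Fin 2) ℂ) :=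
    fun b => B7Prop2Explicit.mem_unitaryUnits.mp (unitsField_mem_unitaryUnits (toUField U₀) b)
  have hLF : ((F.P K).L : ℝ) = (F.L : ℝ) := by norm_cast
  have hd : ((F.P K).d : ℝ) = 3 := by norm_num [T3ContinuumYM3Torus.T3Family.P_d]
  have hL0 : (0 : ℝ) < ((F.L : ℝ) ^ (K - n)) ^ 2 := by
    have : (0 : ℝ) < F.L := by have := F.hL.2; exact_mod_cast (by omega : 0 < F.L)
    positivity
  have ha0 : 0 ≤ ε * (((F.L : ℝ) ^ (K - n)) ^ 2)⁻¹ := mul_nonneg hε (inv_pos.mpr hL0).le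
  -- (1) the general covariant Poincaré (no kernel hypothesis)
  have hP := sum_normSq_le_covLineAvg_add_covGrad hV ha0 hplaq (Prop7FlatCoercivity.sitesPerDir_T3 F n K) Y
  rw [hLF, hd] at hP
  -- (2) op ≤ HS for the gradient, Weitzenböck, HS ≤ N op for the zeroth order
  have hgrad : ∑ b : PBond (F.P K) 0, ∑ ν : Fin (F.P K).d, ‖conjR (unitsField (toUField U₀) ⟨b.src, ν⟩) (Y ⟨b.src.shift ν, b.dir⟩) - Y b‖ ^ 2
      ≤ ∑ x : Site (F.P K) 0, ∑ μ : Fin (F.P K).d, ∑ ν : Fin (F.P K).d, ∑ j : Fin 2, ∑ k : Fin 2,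
          ‖(covD (torusT (F.P K) 0) (fun κ z => unitsField (toUField U₀) ⟨z, κ⟩) ν (fun z => Y ⟨z, μ⟩) x) j k‖ ^ 2 := by
    rw [sum_pbond]
    refine Finset.sum_le_sum fun x _ => Finset.sum_le_sum fun μ _ => Finset.sum_le_sum fun ν _ => ?_
    exact MatrixNorms.opNorm_sq_le_sum_norm_sq _
  have hU' : ∀ (ν : Fin (F.P K).d) (x : Site (F.P K) 0),
      ((fun κ z => unitsField (toUField U₀) ⟨z, κ⟩) ν x : Matrix (Fin 2) (Fin 2) ℂ) ∈ unitary (Matrix (Fin 2) (Fin 2) ℂ) := fun ν x => hVu _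
  have hW := sum_covD_sq_le_curl_sq_add_divB_sq hU' (plaqU_hyp ha0 hplaq) (fun κ z => Y ⟨z, κ⟩)
  rw [hd] at hW
  have hzero : ∑ x : Site (F.P K) 0, ∑ μ : Fin (F.P K).d, ∑ j : Fin 2, ∑ k : Fin 2, ‖((fun κ z => Y ⟨z, κ⟩) μ x) j k‖ ^ 2
      ≤ 2 * ∑ b : PBond (F.P K) 0, ‖Y b‖ ^ 2 := by
    rw [sum_pbond, Finset.mul_sum]
    refine Finset.sum_le_sum fun x _ => ?_
    rw [Finset.mul_sum]
    refine Finset.sum_le_sum fun μ _ => ?_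
    have := sum_norm_sq_le_mul_opNorm_sq (Y ⟨x, μ⟩)
    push_cast at this
    exact this
  -- (3) assemble
  set w : ℝ := (((F.L : ℝ) ^ (K - n)) ^ 2)⁻¹ with hw_def
  have hw0 : 0 < w := inv_pos.mpr hL0
  have e1 : ((F.L : ℝ) ^ (K - n)) ^ 2 * w = 1 := by rw [hw_def, mul_inv_cancel₀ hL0.ne']
  have hS0 : 0 ≤ ∑ b : PBond (F.P K) 0, ‖Y b‖ ^ 2 := Finset.sum_nonneg fun _ _ => sq_nonneg _
  have hA0 : 0 ≤ ∑ c : PBond (F.P K) (K - n), ‖∑ r : Fin (F.P K).d → Fin ((F.P K).L ^ (K - n)), ∑ t ∈ range ((F.P K).L ^ (K - n)),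
        conjR (holT (unitsField (toUField U₀)) (Site.fibreSite 0 (K - n) c.src fun _ => ⟨0, pow_pos (F.P K).L_pos (K - n)⟩)
              (treeWord fun ν => ((r ν : ℕ) : ℤ))
            * holT (unitsField (toUField U₀)) (Site.fibreSite 0 (K - n) c.src r) (List.replicate t (c.dir, true)))
          (Y ⟨(fun z : Site (F.P K) 0 => z.shift c.dir)^[t] (Site.fibreSite 0 (K - n) c.src r), c.dir⟩)‖ ^ 2 := Finset.sum_nonneg fun _ _ => sq_nonneg _
  have hCD0 : 0 ≤ (∑ x : Site (F.P K) 0, ∑ μ : Fin (F.P K).d, ∑ ν : Fin (F.P K).d,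
            (if μ < ν then ∑ j : Fin 2, ∑ k : Fin 2,
              ‖(curl (torusT (F.P K) 0) (fun κ z => unitsField (toUField U₀) ⟨z, κ⟩) (fun κ z => Y ⟨z, κ⟩) μ ν x) j k‖ ^ 2 else 0)
          + ∑ x : Site (F.P K) 0, ∑ j : Fin 2, ∑ k : Fin 2,
              ‖(divB (torusT (F.P K) 0) (fun κ z => unitsField (toUField U₀) ⟨z, κ⟩) (fun κ z => Y ⟨z, κ⟩) x) j k‖ ^ 2) := by
    refine add_nonneg (Finset.sum_nonneg fun _ _ => Finset.sum_nonneg fun _ _ => Finset.sum_nonneg fun _ _ => ?_)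
      (Finset.sum_nonneg fun _ _ => Finset.sum_nonneg fun _ _ => Finset.sum_nonneg fun _ _ => sq_nonneg _)
    split_ifs
    · exact Finset.sum_nonneg fun _ _ => Finset.sum_nonneg fun _ _ => sq_nonneg _
    · exact le_rfl
  push_cast at hP hW hzero hgrad
  have hεw : (((F.L : ℝ) ^ (K - n)) ^ 2 * (ε * w)) ^ 2 = ε ^ 2 := by
    rw [show ((F.L : ℝ) ^ (K - n)) ^ 2 * (ε * w) = ε * (((F.L : ℝ) ^ (K - n)) ^ 2 * w) by ring, e1, mul_one]
  rw [hεw] at hP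
  have hgW := hgrad.trans hW
  -- the gradient term times `(L^k)²`, with `(L^k)²·w = 1`
  have hG' := mul_le_mul_of_nonneg_left hgW hL0.le
  have e2 : ∀ (CD HS : ℝ), ((F.L : ℝ) ^ (K - n)) ^ 2 * (CD + 2 * 3 * (ε * w) * HS)
      = ((F.L : ℝ) ^ (K - n)) ^ 2 * CD + 6 * ε * (((F.L : ℝ) ^ (K - n)) ^ 2 * w) * HS := fun CD HS => by ring
  rw [e2, e1, mul_one] at hG'
  have hHS := mul_le_mul_of_nonneg_left hzero (by positivity : (0 : ℝ) ≤ 6 * ε)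
  -- scalar smallness
  have hεS : ε * ∑ b : PBond (F.P K) 0, ‖Y b‖ ^ 2 ≤ (1 / 216) * ∑ b : PBond (F.P K) 0, ‖Y b‖ ^ 2 :=
    mul_le_mul_of_nonneg_right (by linarith only [hε1]) hS0
  have hε2S : ε ^ 2 * ∑ b : PBond (F.P K) 0, ‖Y b‖ ^ 2 ≤ (1 / 216) ^ 2 * ∑ b : PBond (F.P K) 0, ‖Y b‖ ^ 2 :=
    mul_le_mul_of_nonneg_right (pow_le_pow_left₀ hε (by linarith only [hε1]) 2) hS0
  have hWd0 : 0 ≤ (((F.L : ℝ) ^ (K - n)) ^ (F.P K).d * ((F.L : ℝ) ^ (K - n)) ^ 2)⁻¹ := by positivity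
  -- `S ≤ 18·L^{2k}·(CURL+DIV) + 16·W_d·AVG`
  have hmain : ∑ b : PBond (F.P K) 0, ‖Y b‖ ^ 2
      ≤ 18 * ((F.L : ℝ) ^ (K - n)) ^ 2 * (∑ x : Site (F.P K) 0, ∑ μ : Fin (F.P K).d, ∑ ν : Fin (F.P K).d,
            (if μ < ν then ∑ j : Fin 2, ∑ k : Fin 2,
              ‖(curl (torusT (F.P K) 0) (fun κ z => unitsField (toUField U₀) ⟨z, κ⟩) (fun κ z => Y ⟨z, κ⟩) μ ν x) j k‖ ^ 2 else 0)
          + ∑ x : Site (F.P K) 0, ∑ j : Fin 2, ∑ k : Fin 2,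
              ‖(divB (torusT (F.P K) 0) (fun κ z => unitsField (toUField U₀) ⟨z, κ⟩) (fun κ z => Y ⟨z, κ⟩) x) j k‖ ^ 2)
        + 16 * (((F.L : ℝ) ^ (K - n)) ^ (F.P K).d * ((F.L : ℝ) ^ (K - n)) ^ 2)⁻¹ * ∑ c : PBond (F.P K) (K - n), ‖∑ r : Fin (F.P K).d → Fin ((F.P K).L ^ (K - n)), ∑ t ∈ range ((F.P K).L ^ (K - n)),
        conjR (holT (unitsField (toUField U₀)) (Site.fibreSite 0 (K - n) c.src fun _ => ⟨0, pow_pos (F.P K).L_pos (K - n)⟩)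
              (treeWord fun ν => ((r ν : ℕ) : ℤ))
            * holT (unitsField (toUField U₀)) (Site.fibreSite 0 (K - n) c.src r) (List.replicate t (c.dir, true)))
          (Y ⟨(fun z : Site (F.P K) 0 => z.shift c.dir)^[t] (Site.fibreSite 0 (K - n) c.src r), c.dir⟩)‖ ^ 2 := by
    nlinarith [hP, hG', hHS, hεS, hε2S, hS0, hA0, hCD0, mul_nonneg hWd0 hA0, mul_nonneg hL0.le hCD0]
  -- multiply by `w`
  have := mul_le_mul_of_nonneg_left hmain hw0.le
  have e3 : w * (18 * ((F.L : ℝ) ^ (K - n)) ^ 2 * (∑ x : Site (F.P K) 0, ∑ μ : Fin (F.P K).d, ∑ ν : Fin (F.P K).d,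
            (if μ < ν then ∑ j : Fin 2, ∑ k : Fin 2,
              ‖(curl (torusT (F.P K) 0) (fun κ z => unitsField (toUField U₀) ⟨z, κ⟩) (fun κ z => Y ⟨z, κ⟩) μ ν x) j k‖ ^ 2 else 0)
          + ∑ x : Site (F.P K) 0, ∑ j : Fin 2, ∑ k : Fin 2,
              ‖(divB (torusT (F.P K) 0) (fun κ z => unitsField (toUField U₀) ⟨z, κ⟩) (fun κ z => Y ⟨z, κ⟩) x) j k‖ ^ 2)
        + 16 * (((F.L : ℝ) ^ (K - n)) ^ (F.P K).d * ((F.L : ℝ) ^ (K - n)) ^ 2)⁻¹ * ∑ c : PBond (F.P K) (K - n), ‖∑ r : Fin (F.P K).d → Fin ((F.P K).L ^ (K - n)), ∑ t ∈ range ((F.P K).L ^ (K - n)),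
        conjR (holT (unitsField (toUField U₀)) (Site.fibreSite 0 (K - n) c.src fun _ => ⟨0, pow_pos (F.P K).L_pos (K - n)⟩)
              (treeWord fun ν => ((r ν : ℕ) : ℤ))
            * holT (unitsField (toUField U₀)) (Site.fibreSite 0 (K - n) c.src r) (List.replicate t (c.dir, true)))
          (Y ⟨(fun z : Site (F.P K) 0 => z.shift c.dir)^[t] (Site.fibreSite 0 (K - n) c.src r), c.dir⟩)‖ ^ 2)
      = 18 * (∑ x : Site (F.P K) 0, ∑ μ : Fin (F.P K).d, ∑ ν : Fin (F.P K).d,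
            (if μ < ν then ∑ j : Fin 2, ∑ k : Fin 2,
              ‖(curl (torusT (F.P K) 0) (fun κ z => unitsField (toUField U₀) ⟨z, κ⟩) (fun κ z => Y ⟨z, κ⟩) μ ν x) j k‖ ^ 2 else 0)
          + ∑ x : Site (F.P K) 0, ∑ j : Fin 2, ∑ k : Fin 2,
              ‖(divB (torusT (F.P K) 0) (fun κ z => unitsField (toUField U₀) ⟨z, κ⟩) (fun κ z => Y ⟨z, κ⟩) x) j k‖ ^ 2)
        + 16 * ((((F.L : ℝ) ^ (K - n)) ^ (F.P K).d * ((F.L : ℝ) ^ (K - n)) ^ 2)⁻¹ * w) * ∑ c : PBond (F.P K) (K - n), ‖∑ r : Fin (F.P K).d → Fin ((F.P K).L ^ (K - n)), ∑ t ∈ range ((F.P K).L ^ (K - n)),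
        conjR (holT (unitsField (toUField U₀)) (Site.fibreSite 0 (K - n) c.src fun _ => ⟨0, pow_pos (F.P K).L_pos (K - n)⟩)
              (treeWord fun ν => ((r ν : ℕ) : ℤ))
            * holT (unitsField (toUField U₀)) (Site.fibreSite 0 (K - n) c.src r) (List.replicate t (c.dir, true)))
          (Y ⟨(fun z : Site (F.P K) 0 => z.shift c.dir)^[t] (Site.fibreSite 0 (K - n) c.src r), c.dir⟩)‖ ^ 2 := by
    linear_combination (18 * (∑ x : Site (F.P K) 0, ∑ μ : Fin (F.P K).d, ∑ ν : Fin (F.P K).d,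
            (if μ < ν then ∑ j : Fin 2, ∑ k : Fin 2,
              ‖(curl (torusT (F.P K) 0) (fun κ z => unitsField (toUField U₀) ⟨z, κ⟩) (fun κ z => Y ⟨z, κ⟩) μ ν x) j k‖ ^ 2 else 0)
          + ∑ x : Site (F.P K) 0, ∑ j : Fin 2, ∑ k : Fin 2,
              ‖(divB (torusT (F.P K) 0) (fun κ z => unitsField (toUField U₀) ⟨z, κ⟩) (fun κ z => Y ⟨z, κ⟩) x) j k‖ ^ 2)) * e1
  rw [e3] at this
  exact this

/-! ## §2 The non-flat local-minimality model off the kernel -/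

/-- **THE NON-FLAT LOCAL-MINIMALITY MODEL OFF THE KERNEL, d = 3 CARRIER**: as `wilsonAction4_sub_background_ge_T3` (background in (14) with `216ε ≤ 1`,
`Y = UU₀^* − 1` within `δ ≤ 1`, covariant Landau gauge `D^*_{U₀}Y = 0`) but WITHOUT the average-zero hypothesis — the covariant block averages enter as the penalty
`(1/18)(L^{3(K−n)}L^{2(K−n)})^{−1}L^{−2(K−n)}Σ_c‖A^{U₀}_cY‖²` on the left. [cite: Balaban1985Variational, (141)-(143) p.299, (20)-(21) p.281] -/
theorem wilsonAction4_sub_background_ge_offKernel_T3 (F : T3ContinuumYM3Torus.T3Family) (n K : ℕ)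
    (U U₀ : GaugeField (F.P K) 0 (Matrix.specialUnitaryGroup (Fin 2) ℂ)) {ε δ : ℝ} (hε : 0 ≤ ε) (hε1 : 216 * ε ≤ 1)
    (hU₀ : ∀ p : Plaq (F.P K) 0, dist1 (GaugeField.plaqHol U₀ p) ≤ ε * (((F.L : ℝ) ^ (K - n)) ^ 2)⁻¹)
    (hδ : ∀ b : PBond (F.P K) 0, ‖(U b : Matrix (Fin 2) (Fin 2) ℂ) * star (U₀ b : Matrix (Fin 2) (Fin 2) ℂ) - 1‖ ≤ δ) (hδ1 : δ ≤ 1)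
    (hdiv : ∀ x : Site (F.P K) 0, divB (torusT (F.P K) 0) (fun κ z => unitsField (toUField U₀) ⟨z, κ⟩)
      (fun κ z => (U ⟨z, κ⟩ : Matrix (Fin 2) (Fin 2) ℂ) * star (U₀ ⟨z, κ⟩ : Matrix (Fin 2) (Fin 2) ℂ) - 1) x = 0) :
    ((1 / 288) * (((F.L : ℝ) ^ (K - n)) ^ 2)⁻¹
        - 12 * (2 * (ε * (((F.L : ℝ) ^ (K - n)) ^ 2)⁻¹) ^ 2 + 128 * δ ^ 2 + 8 * (ε * (((F.L : ℝ) ^ (K - n)) ^ 2)⁻¹)))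
        * ∑ b : PBond (F.P K) 0, ‖(U b : Matrix (Fin 2) (Fin 2) ℂ) * star (U₀ b : Matrix (Fin 2) (Fin 2) ℂ) - 1‖ ^ 2
      - (1 / 18) * (((((F.L : ℝ) ^ (K - n)) ^ (F.P K).d) * ((F.L : ℝ) ^ (K - n)) ^ 2)⁻¹ * (((F.L : ℝ) ^ (K - n)) ^ 2)⁻¹)
        * ∑ c : PBond (F.P K) (K - n), ‖∑ r : Fin (F.P K).d → Fin ((F.P K).L ^ (K - n)), ∑ t ∈ range ((F.P K).L ^ (K - n)),
        conjR (holT (unitsField (toUField U₀)) (Site.fibreSite 0 (K - n) c.src fun _ => ⟨0, pow_pos (F.P K).L_pos (K - n)⟩)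
              (treeWord fun ν => ((r ν : ℕ) : ℤ))
            * holT (unitsField (toUField U₀)) (Site.fibreSite 0 (K - n) c.src r) (List.replicate t (c.dir, true)))
          ((U ⟨(fun z : Site (F.P K) 0 => z.shift c.dir)^[t] (Site.fibreSite 0 (K - n) c.src r), c.dir⟩ : Matrix (Fin 2) (Fin 2) ℂ)
              * star (U₀ ⟨(fun z : Site (F.P K) 0 => z.shift c.dir)^[t] (Site.fibreSite 0 (K - n) c.src r), c.dir⟩ : Matrix (Fin 2) (Fin 2) ℂ) - 1)‖ ^ 2
      ≤ wilsonAction4 U - wilsonAction4 U₀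
        - ∑ p : Plaq (F.P K) 0, (1 / 2) * ((((((GaugeField.plaqHol U₀ p : Matrix.specialUnitaryGroup (Fin 2) ℂ) : Matrix (Fin 2) (Fin 2) ℂ)) - 1)ᴴ
          * ((((U ⟨p.src, p.μ⟩ : Matrix (Fin 2) (Fin 2) ℂ) * star (U₀ ⟨p.src, p.μ⟩ : Matrix (Fin 2) (Fin 2) ℂ) - 1)
              + (U₀ ⟨p.src, p.μ⟩ : Matrix (Fin 2) (Fin 2) ℂ)
                  * ((U ⟨p.src.shift p.μ, p.ν⟩ : Matrix (Fin 2) (Fin 2) ℂ) * star (U₀ ⟨p.src.shift p.μ, p.ν⟩ : Matrix (Fin 2) (Fin 2) ℂ) - 1)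
                  * star (U₀ ⟨p.src, p.μ⟩ : Matrix (Fin 2) (Fin 2) ℂ)
              - ((U₀ ⟨p.src, p.μ⟩ * U₀ ⟨p.src.shift p.μ, p.ν⟩ * (U₀ ⟨p.src.shift p.ν, p.μ⟩)⁻¹ : Matrix.specialUnitaryGroup (Fin 2) ℂ) : Matrix (Fin 2) (Fin 2) ℂ)
                  * ((U ⟨p.src.shift p.ν, p.μ⟩ : Matrix (Fin 2) (Fin 2) ℂ) * star (U₀ ⟨p.src.shift p.ν, p.μ⟩ : Matrix (Fin 2) (Fin 2) ℂ) - 1)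
                  * star ((U₀ ⟨p.src, p.μ⟩ * U₀ ⟨p.src.shift p.μ, p.ν⟩ * (U₀ ⟨p.src.shift p.ν, p.μ⟩)⁻¹ : Matrix.specialUnitaryGroup (Fin 2) ℂ) : Matrix (Fin 2) (Fin 2) ℂ)
              - ((GaugeField.plaqHol U₀ p : Matrix.specialUnitaryGroup (Fin 2) ℂ) : Matrix (Fin 2) (Fin 2) ℂ)
                  * ((U ⟨p.src, p.ν⟩ : Matrix (Fin 2) (Fin 2) ℂ) * star (U₀ ⟨p.src, p.ν⟩ : Matrix (Fin 2) (Fin 2) ℂ) - 1)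
                  * star ((GaugeField.plaqHol U₀ p : Matrix.specialUnitaryGroup (Fin 2) ℂ) : Matrix (Fin 2) (Fin 2) ℂ))
            * ((GaugeField.plaqHol U₀ p : Matrix.specialUnitaryGroup (Fin 2) ℂ) : Matrix (Fin 2) (Fin 2) ℂ))).trace).re := by
  set Y : PBond (F.P K) 0 → Matrix (Fin 2) (Fin 2) ℂ := fun b => (U b : Matrix (Fin 2) (Fin 2) ℂ) * star (U₀ b : Matrix (Fin 2) (Fin 2) ℂ) - 1 with hY
  set a : ℝ := ε * (((F.L : ℝ) ^ (K - n)) ^ 2)⁻¹ with ha_def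
  have hL0 : (0 : ℝ) < ((F.L : ℝ) ^ (K - n)) ^ 2 := by
    have : (0 : ℝ) < F.L := by have := F.hL.2; exact_mod_cast (by omega : 0 < F.L)
    positivity
  have ha : 0 ≤ a := mul_nonneg hε (inv_pos.mpr hL0).le
  -- (1) the per-plaquette expansion, summed
  have hper := fun p : Plaq (F.P K) 0 => quarter_hs_plaq_expansion_ge U U₀ p ha (hU₀ p) hδ hδ1
  have hsum := Finset.sum_le_sum fun p (_ : p ∈ (Finset.univ : Finset (Plaq (F.P K) 0))) => hper p
  rw [← wilsonAction4_eq_quarter_sum_hs U] at hsum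
  simp only [Finset.sum_sub_distrib, Finset.sum_add_distrib, ← Finset.mul_sum] at hsum
  have hA0 : (1 / 4 : ℝ) * ∑ p : Plaq (F.P K) 0, ∑ i₁ : Fin 2, ∑ i₂ : Fin 2,
      ‖((((GaugeField.plaqHol U₀ p : Matrix.specialUnitaryGroup (Fin 2) ℂ) : Matrix (Fin 2) (Fin 2) ℂ)) - 1) i₁ i₂‖ ^ 2 = wilsonAction4 U₀ := by
    rw [wilsonAction4_eq_quarter_sum_hs, Finset.mul_sum]
  rw [hA0] at hsum
  -- (2) the covariant curl form through Thm 3.11 at the small-field background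
  have hcurl : ∑ p : Plaq (F.P K) 0, ∑ i₁ : Fin 2, ∑ i₂ : Fin 2,
        ‖(((U ⟨p.src, p.μ⟩ : Matrix (Fin 2) (Fin 2) ℂ) * star (U₀ ⟨p.src, p.μ⟩ : Matrix (Fin 2) (Fin 2) ℂ) - 1)
            + (U₀ ⟨p.src, p.μ⟩ : Matrix (Fin 2) (Fin 2) ℂ)
                * ((U ⟨p.src.shift p.μ, p.ν⟩ : Matrix (Fin 2) (Fin 2) ℂ) * star (U₀ ⟨p.src.shift p.μ, p.ν⟩ : Matrix (Fin 2) (Fin 2) ℂ) - 1)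
                * star (U₀ ⟨p.src, p.μ⟩ : Matrix (Fin 2) (Fin 2) ℂ)
            - (U₀ ⟨p.src, p.ν⟩ : Matrix (Fin 2) (Fin 2) ℂ)
                * ((U ⟨p.src.shift p.ν, p.μ⟩ : Matrix (Fin 2) (Fin 2) ℂ) * star (U₀ ⟨p.src.shift p.ν, p.μ⟩ : Matrix (Fin 2) (Fin 2) ℂ) - 1)
                * star (U₀ ⟨p.src, p.ν⟩ : Matrix (Fin 2) (Fin 2) ℂ)
            - ((U ⟨p.src, p.ν⟩ : Matrix (Fin 2) (Fin 2) ℂ) * star (U₀ ⟨p.src, p.ν⟩ : Matrix (Fin 2) (Fin 2) ℂ) - 1)) i₁ i₂‖ ^ 2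
      = ∑ x : Site (F.P K) 0, ∑ μ : Fin (F.P K).d, ∑ ν : Fin (F.P K).d,
          (if μ < ν then ∑ i₁ : Fin 2, ∑ i₂ : Fin 2,
            ‖(B9Eq39Adjoint.curl (torusT (F.P K) 0) (fun κ z => unitsField (toUField U₀) ⟨z, κ⟩) (fun κ z => Y ⟨z, κ⟩) μ ν x) i₁ i₂‖ ^ 2 else 0) := by
    rw [← sum_plaq_eq_sum_ite (fun x μ ν => ∑ i₁ : Fin 2, ∑ i₂ : Fin 2,
      ‖(B9Eq39Adjoint.curl (torusT (F.P K) 0) (fun κ z => unitsField (toUField U₀) ⟨z, κ⟩) (fun κ z => Y ⟨z, κ⟩) μ ν x) i₁ i₂‖ ^ 2)]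
    refine Finset.sum_congr rfl fun p _ => ?_
    rw [curl_bg_eq U₀ Y p]
  have h311 := sum_normSq_le_curl_sq_add_divB_sq_add_avg_T3 F n K U₀ hε hε1 hU₀ Y
  have hdiv0 : ∑ x : Site (F.P K) 0, ∑ j : Fin 2, ∑ k : Fin 2,
      ‖(divB (torusT (F.P K) 0) (fun κ z => unitsField (toUField U₀) ⟨z, κ⟩) (fun κ z => Y ⟨z, κ⟩) x) j k‖ ^ 2 = 0 := by
    refine Finset.sum_eq_zero fun x _ => ?_
    rw [hdiv x]
    simp
  rw [hdiv0, add_zero, ← hcurl] at h311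
  -- (3) the error terms through the bond–plaquette incidence
  have hinc := sum_plaq_bonds_le (P := F.P K) (j := 0) (fun b => ‖Y b‖ ^ 2) (fun b => sq_nonneg _)
  have hd : ((F.P K).d : ℝ) = 3 := by norm_num [T3ContinuumYM3Torus.T3Family.P_d]
  rw [hd] at hinc
  have hc0 : 0 ≤ 2 * a ^ 2 + 128 * δ ^ 2 + 8 * a := by positivity
  have herr := mul_le_mul_of_nonneg_left hinc hc0
  simp only [Finset.sum_add_distrib] at herr
  -- assemble
  simp only [hY] at h311 herr hsum
  rw [← Finset.mul_sum]
  linarith [hsum, h311, herr]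


end Summit.QuantumFields.YangMills.Theorems.Prop7CovariantCoercivity

end
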